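import Literature.Probability.RandomPlanarGeometry.WholePlaneOrbitStability
import Mathlib.MeasureTheory.Constructions.BorelSpace.Metrizable
import HarnessLib

/-!
# Continuity of the backward trajectories and measurability of the whole-plane inverse maps in a parameter

Topic `Probability/RandomPlanarGeometry`; theorems only (no definition, no named fact). Sequel of
`WholePlaneOrbitStability`. Let a parameter `ω` in a topological space drive a family of
continuous driving angles `Λ ω : ℝ → ℝ` which depends continuously on `ω` locally uniformly in time
(for every compact time window `[t - L, t]`, `Λ ω' → Λ ω` uniformly as `ω' → ω`), and let
`W ω`, `|W ω| > 1`, be a point depending continuously on `ω`.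

* `WholePlaneLoewner.BackwardFlow.continuous_orbit_param` — `ω ↦ orbit (Λ ω) t (W ω) (t - L)` is
  continuous (Grönwall, `dist_orbit_orbit_le`);
* `WholePlaneLoewner.BackwardFlow.measurable_invMap_param` — hence `ω ↦ F_t^{Λ ω}(W ω) =
  invMap (Λ ω) t (W ω)` is Borel measurable: it is the everywhere limit of the continuous maps
  `ω ↦ e^{t - n} orbit (Λ ω) t (W ω) (t - n)` (`norm_exp_mul_orbit_sub_invMap_le`).

This is the whole-plane analogue of the measurability of the chordal inverse Loewner map in the
driving function (Rohde–Schramm (2005), §3: "`f̂ₛ` is measurable"; tree `Loewner.measurable_loewnerInv`).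

## References

* S. Rohde, O. Schramm, *Basic properties of SLE*, Ann. of Math. 161 (2005), §3. [RohdeSchramm2005]
* G. F. Lawler, *Conformally Invariant Processes in the Plane*, AMS (2005), §4.3. [Lawler2005]
-/

noncomputable section

open Set Filter Topology Metric Complex MeasureTheory
open scoped NNReal

namespace Literature.Probability.RandomPlanarGeometry

namespace WholePlaneLoewner.BackwardFlow

variable {Ω : Type*} [TopologicalSpace Ω] {Λ : Ω → ℝ → ℝ} {W : Ω → ℂ}

/-- The error constant at the real point `1 + δ`. [folklore] -/
theorem errConst_ofReal_one_add {δ : ℝ} (hδ : 0 < δ) :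
    errConst (((1 + δ : ℝ)) : ℂ) = 2 * (2 + δ) / δ ^ 2 := by
  rw [errConst_apply, Complex.norm_real, Real.norm_eq_abs, abs_of_pos (by linarith)]
  ring_nf

/-- **Continuity of the backward trajectory in the parameter.** [cite: Lawler2005, §4.3] -/
theorem continuous_orbit_param (hΛc : ∀ ω, Continuous (Λ ω))
    (hΛ : ∀ (a b : ℝ) (ω₀ : Ω) (ε : ℝ), 0 < ε → ∀ᶠ ω in 𝓝 ω₀, ∀ s ∈ Icc a b, |Λ ω s - Λ ω₀ s| ≤ ε)
    (hW : Continuous W) (hW1 : ∀ ω, 1 < ‖W ω‖) (t : ℝ) {L : ℝ} (hL : 0 ≤ L) :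
    Continuous fun ω ↦ orbit (Λ ω) t (W ω) (t - L) := by
  refine continuous_iff_continuousAt.2 fun ω₀ ↦ ?_
  rw [ContinuousAt, Metric.tendsto_nhds]
  intro η hη
  set w₀ := W ω₀ with hw₀
  have hw₀1 : 1 < ‖w₀‖ := hW1 ω₀
  -- a uniform annulus around `w₀`
  set d : ℝ := (‖w₀‖ - 1) / 2 with hd
  have hdpos : 0 < d := by rw [hd]; linarith
  set δ : ℝ≥0 := ⟨d, hdpos.le⟩ with hδ
  have hδpos : 0 < δ := by rw [← NNReal.coe_pos]; exact hdpos
  have hδc : ((δ : ℝ≥0) : ℝ) = d := rfl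
  -- constants
  set K : ℝ := 1 + 2 / (δ : ℝ) ^ 2 with hK
  have hKpos : 0 < K := by rw [hK]; positivity
  set M : ℝ := 2 * (2 + d) / d ^ 2 with hM
  set B : ℝ := (‖w₀‖ + d) * Real.exp L * Real.exp M with hB
  have hBpos : 0 < B := by rw [hB]; have := norm_nonneg w₀; positivity
  set C : ℝ := 2 + 2 * (1 + 2 * B) / (δ : ℝ) ^ 2 with hC
  have hCpos : 0 < C := by rw [hC]; positivity
  -- choose the sizes of the perturbations
  set η₁ : ℝ := η / 2 / Real.exp (K * L) with hη₁
  have hη₁pos : 0 < η₁ := by rw [hη₁]; positivity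
  set ε : ℝ := η / 2 * K / (C * Real.exp (K * L)) with hε
  have hεpos : 0 < ε := by rw [hε]; positivity
  -- neighbourhood conditions
  have h1 : ∀ᶠ ω in 𝓝 ω₀, dist (W ω) w₀ < min d η₁ :=
    (Metric.tendsto_nhds.1 (hW.tendsto ω₀)) _ (lt_min hdpos hη₁pos)
  have h2 := hΛ (t - L) t ω₀ ε hεpos
  filter_upwards [h1, h2] with ω hω1 hω2
  have hωd : dist (W ω) w₀ < d := hω1.trans_le (min_le_left _ _)
  have hωη : dist (W ω) w₀ < η₁ := hω1.trans_le (min_le_right _ _)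
  -- the annulus conditions
  have hw : 1 + (δ : ℝ) ≤ ‖w₀‖ := by rw [hδc, hd]; linarith
  have hw' : 1 + (δ : ℝ) ≤ ‖W ω‖ := by
    have := norm_sub_norm_le w₀ (W ω)
    rw [← dist_eq_norm, dist_comm] at this
    rw [hδc]; linarith
  have hw'le : ‖W ω‖ ≤ ‖w₀‖ + d := by
    have := norm_sub_norm_le (W ω) w₀
    rw [← dist_eq_norm] at this
    linarith
  have hw'1 : 1 < ‖W ω‖ := hW1 ω
  -- the a priori bound `B`
  have hMω : errConst (W ω) ≤ M := by
    have h := errConst_anti (w := (((1 + d : ℝ)) : ℂ)) (w' := W ω)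
      (by rw [Complex.norm_real, Real.norm_eq_abs, abs_of_pos (by linarith)]; linarith)
      (by rw [Complex.norm_real, Real.norm_eq_abs, abs_of_pos (by linarith)]; rw [hδc] at hw'; exact hw')
    rwa [errConst_ofReal_one_add hdpos] at h
  have hBω : ‖W ω‖ * Real.exp L * Real.exp (errConst (W ω)) ≤ B := by
    rw [hB]
    gcongr
  -- Grönwall
  have hG := dist_orbit_orbit_le (hΛc ω₀) (hΛc ω) hL hδpos hw hw' hBω
    (fun s hs ↦ hω2 s hs)
  rw [dist_comm]
  refine hG.trans_lt ?_
  rw [gronwallBound_of_K_ne_0 hKpos.ne']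
  simp only
  have hexp1 : 1 ≤ Real.exp (K * L) := Real.one_le_exp (by positivity)
  have hA : dist w₀ (W ω) * Real.exp (K * L) < η / 2 := by
    rw [dist_comm]
    calc dist (W ω) w₀ * Real.exp (K * L) < η₁ * Real.exp (K * L) :=
          mul_lt_mul_of_pos_right hωη (by positivity)
      _ = η / 2 := by rw [hη₁]; field_simp
  have hBd : C * ε / K * (Real.exp (K * L) - 1) ≤ η / 2 := by
    have h1 : C * ε / K = η / 2 / Real.exp (K * L) := by
      rw [hε]; field_simp
    rw [h1]
    calc η / 2 / Real.exp (K * L) * (Real.exp (K * L) - 1)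
        ≤ η / 2 / Real.exp (K * L) * Real.exp (K * L) :=
          mul_le_mul_of_nonneg_left (by linarith) (by positivity)
      _ = η / 2 := by field_simp
  linarith

variable [MeasurableSpace Ω] [OpensMeasurableSpace Ω]

/-- **Measurability of the whole-plane inverse map in the parameter**: `ω ↦ F_t^{Λ ω}(W ω)` is
Borel measurable (everywhere limit of the continuous `ω ↦ e^{t-n} orbit (Λ ω) t (W ω) (t - n)`,
`norm_exp_mul_orbit_sub_invMap_le`). [cite: RohdeSchramm2005, §3] -/
theorem measurable_invMap_param (hΛc : ∀ ω, Continuous (Λ ω))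
    (hΛ : ∀ (a b : ℝ) (ω₀ : Ω) (ε : ℝ), 0 < ε → ∀ᶠ ω in 𝓝 ω₀, ∀ s ∈ Icc a b, |Λ ω s - Λ ω₀ s| ≤ ε)
    (hW : Continuous W) (hW1 : ∀ ω, 1 < ‖W ω‖) (t : ℝ) :
    Measurable fun ω ↦ invMap (Λ ω) t (W ω) := by
  have hf : ∀ n : ℕ, Measurable fun ω ↦ (Real.exp (t - n) : ℂ) * orbit (Λ ω) t (W ω) (t - n) := fun n ↦
    (continuous_const.mul (continuous_orbit_param hΛc hΛ hW hW1 t n.cast_nonneg)).measurable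
  refine measurable_of_tendsto_metrizable hf (tendsto_pi_nhds.2 fun ω ↦ ?_)
  -- the uniform rate at `ω`
  set w := W ω with hw
  have hw1 : 1 < ‖w‖ := hW1 ω
  set d : ℝ := ‖w‖ - 1 with hd
  have hdpos : 0 < d := by rw [hd]; linarith
  have hwd : 1 + d ≤ ‖w‖ := by rw [hd]; linarith
  set M := errConst (((1 + d : ℝ)) : ℂ) with hM
  set c := growthConst (((1 + d : ℝ)) : ℂ) with hc
  have hn1 : 1 < ‖(((1 + d : ℝ)) : ℂ)‖ := by
    rw [Complex.norm_real, Real.norm_eq_abs, abs_of_pos (by linarith)]; linarith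
  have hMpos : 0 < M := errConst_pos hn1
  have hcpos : 0 < c := growthConst_pos' hn1
  rw [tendsto_iff_norm_sub_tendsto_zero]
  -- the bound `A · (M e^{-c n})` tends to `0`
  have hlim : Tendsto (fun n : ℕ ↦ Real.exp t * ‖w‖ * Real.exp M * (2 * (M * Real.exp (-(c * (t - (t - n))))))) atTop (𝓝 0) := by
    have h1 : Tendsto (fun n : ℕ ↦ Real.exp (-(c * (n : ℝ)))) atTop (𝓝 0) := by
      have := (Real.tendsto_exp_neg_atTop_nhds_zero).comp ((tendsto_natCast_atTop_atTop (R := ℝ)).const_mul_atTop hcpos)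
      exact this
    have h2 : (fun n : ℕ ↦ Real.exp t * ‖w‖ * Real.exp M * (2 * (M * Real.exp (-(c * (t - (t - n))))))) =
        fun n : ℕ ↦ (Real.exp t * ‖w‖ * Real.exp M * (2 * M)) * Real.exp (-(c * (n : ℝ))) := by
      funext n; ring_nf
    rw [h2]
    simpa using h1.const_mul (Real.exp t * ‖w‖ * Real.exp M * (2 * M))
  have hsmall : ∀ᶠ n : ℕ in atTop, M * Real.exp (-(c * (t - (t - n)))) ≤ 1 := by
    have h1 : Tendsto (fun n : ℕ ↦ M * Real.exp (-(c * (t - (t - n))))) atTop (𝓝 0) := by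
      have := (Real.tendsto_exp_neg_atTop_nhds_zero).comp ((tendsto_natCast_atTop_atTop (R := ℝ)).const_mul_atTop hcpos)
      have h2 : (fun n : ℕ ↦ M * Real.exp (-(c * (t - (t - n))))) = fun n : ℕ ↦ M * Real.exp (-(c * (n : ℝ))) := by
        funext n; ring_nf
      rw [h2]; simpa using this.const_mul M
    exact (h1.eventually (Iic_mem_nhds zero_lt_one)).mono fun n hn ↦ hn
  refine squeeze_zero_norm' ?_ hlim
  filter_upwards [hsmall] with n hn
  rw [norm_norm]
  exact norm_exp_mul_orbit_sub_invMap_le (hΛc ω) hdpos hwd (by linarith) hn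

end WholePlaneLoewner.BackwardFlow

end Literature.Probability.RandomPlanarGeometry
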